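import Mathlib
import Literature.Analysis.FluidPDE.VectorCalculus

/-!
# `SkeletonEquilibrium` (stmt-NavierStokesRegularity-15400): the ℤ₂-symmetries of the Leray–rotating frame — generic transport identity and κ = −1 rigidity

Negative-side structural helper for the (held) support item `FilamentSkeletonRss.SkeletonEquilibrium`
(`--supports stmt-NavierStokesRegularity-15400`); the common generalisation of `…DihedralRigidity` (p831058) and
`…MirrorReversible` (p831101).

SYMMETRY DATA (def-free, coordinates). A diagonal orthogonal map `M = diag(s₀, s₁, s₂)`, `sᵢ = ±1` (every
involutive isometry of the frame commuting or anti-commuting with the rotation `J = e₃×·` and fixing the axis is of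
this form in adapted coordinates: the identity, the half-turns about `e₃` and about a horizontal line, the mirrors
`σ_z` and in a vertical plane, the inversion `−I`), a vertical translation `c = (0, 0, c₂)`, a parameter sign
`ε = ±1` (`ε = −1`: orientations reversed) and an involutive relabelling `π` of the filaments with `γ ∘ π = γ`:
`Ξ_{πk}(εσ)ᵢ = sᵢ Ξ_k(σ)ᵢ + cᵢ` (`hsym`). The sign that matters is `κ := ε · det M = ε s₀s₁s₂`.

* `deriv_apply_symm` — velocities: `Ξ_{πk}′(εσ)ᵢ = ε sᵢ Ξ_k′(σ)ᵢ`.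
* `integral_apply_symm`, `induction_apply_symm` — ★ TRANSPORT of the crux's regularised Biot–Savart induction at
  every field point: `u(Mx + c)ᵢ = κ sᵢ u(x)ᵢ` (vorticity is a pseudo-vector: `(Ma)×(Mb) = det M · M(a×b)`;
  substitution `σ ↦ εσ`; integrability clause to pass to components; reindexing by `π`).
* `transport_identity` — ★ combining the tangency clause at `(k, τ)` and at `(πk, ετ)`:
  `(1 − κ)(½ yᵢ) + ½ sᵢcᵢ − α(s₀s₁ − κ)(Jy)ᵢ = (ε w_{πk}(ετ) − κ w_k τ) Ξ_k′(τ)ᵢ` (components, `y = Ξ_k τ`).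
  The four sign classes: `κ = 1, s₀s₁ = 1` (rotations about `e₃`, `σ_z`/`−I` WITH reversal — the COMPATIBLE
  symmetries; with `c = 0` the slip law `w_{πk}(ετ) = ε w_k(τ)`: `slip_law_of_compatible`); `κ = 1, s₀s₁ = −1`
  (horizontal half-turn preserved / vertical mirror reversed: tangents azimuthal up to `c`, not treated here);
  `κ = −1` (horizontal half-turn WITH reversal = the dihedral class of p831058, vertical mirror PRESERVED, `σ_z` or
  `−I` PRESERVED, `R_π` about `e₃` WITH reversal): RIGID —
* `centre_law_of_neg`, `exists_eq_centre_of_neg`, `subsingleton_of_neg`, `card_le_one_of_neg` — ★ for `κ = −1`: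
  `(I − βJ)(Ξ_k τ − p) = λ Ξ_k′ τ` with `p = −½ s₂c₂ e₃` on the axis, `β = α(1 + s₀s₁)`; hence `‖Ξ_k − p‖²` (proper,
  continuous) has a minimum where `‖Ξ_k − p‖² = λ⟪Ξ_k − p, Ξ_k′⟫ = 0`: EVERY FILAMENT PASSES THROUGH THE AXIS POINT
  `p`, and the separation clause leaves `N ≤ 1`. So none of these symmetric ansätze (dihedral, vertical-mirror,
  horizontal-mirror or inversion symmetric with orientations preserved, `C₂`-antisymmetric pairs) can be a witness
  of `SkeletonEquilibrium` with `N ≥ 2`; for `N = 1` the filament meets the axis.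

Mathlib + `Literature.Analysis.FluidPDE.VectorCalculus` (`cross`) only; no route file imported.
-/

-- `NavierStokesRegularity.NavierStokesRegularity` is the summit/problem path (D-0017), flagged by dupNamespace.
set_option linter.dupNamespace false

namespace Summit.NavierStokesRegularity.NavierStokesRegularity.Theorems.SkeletonEquilibrium.SymmetryRigidity

open Literature.Analysis.FluidPDE MeasureTheory Filter
open scoped RealInnerProductSpace InnerProductSpace BigOperators Topology

/-- Components of the cross product `v × w`. [folklore] -/
private theorem cross_apply_fin3 (v w : EuclideanSpace ℝ (Fin 3)) :
    cross v w 0 = v 1 * w 2 - v 2 * w 1 ∧ cross v w 1 = v 2 * w 0 - v 0 * w 2 ∧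
      cross v w 2 = v 0 * w 1 - v 1 * w 0 := by
  refine ⟨?_, ?_, ?_⟩ <;> simp [cross, cross_apply]

/-- `⟪eᵢ, v⟫ = v i`. [folklore] -/
private theorem inner_single_left' (i : Fin 3) (v : EuclideanSpace ℝ (Fin 3)) :
    ⟪EuclideanSpace.single i (1 : ℝ), v⟫ = v i := by
  rw [EuclideanSpace.inner_single_left]; simp

/-- Components of the frame rotation `e₃ × v = (−v₁, v₀, 0)`. [folklore] -/
private theorem cross_e3_apply (v : EuclideanSpace ℝ (Fin 3)) :
    cross (EuclideanSpace.single (2 : Fin 3) (1 : ℝ)) v 0 = -v 1 ∧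
      cross (EuclideanSpace.single (2 : Fin 3) (1 : ℝ)) v 1 = v 0 ∧
      cross (EuclideanSpace.single (2 : Fin 3) (1 : ℝ)) v 2 = 0 := by
  obtain ⟨h0, h1, h2⟩ := cross_apply_fin3 (EuclideanSpace.single (2 : Fin 3) (1 : ℝ)) v
  rw [h0, h1, h2]
  refine ⟨?_, ?_, ?_⟩ <;> simp

/-- A component of a Bochner integral of an integrable `ℝ³`-valued function is the integral of the
component. [folklore] -/
private theorem integral_apply_eq {F : ℝ → EuclideanSpace ℝ (Fin 3)} (hF : Integrable F) (i : Fin 3) :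
    (∫ σ, F σ) i = ∫ σ, F σ i := by
  rw [← inner_single_left' i, ← integral_inner hF]
  exact integral_congr_ae (Eventually.of_forall fun σ => inner_single_left' i (F σ))

/-- The coordinate functions of a differentiable curve in `ℝ³` are differentiable with derivative the
coordinate of the velocity. [folklore] -/
private theorem hasDerivAt_apply {X : ℝ → EuclideanSpace ℝ (Fin 3)} (hd : Differentiable ℝ X)
    (i : Fin 3) (σ : ℝ) : HasDerivAt (fun σ' => X σ' i) (deriv X σ i) σ := by
  have h := ((EuclideanSpace.proj i : EuclideanSpace ℝ (Fin 3) →L[ℝ] ℝ).hasFDerivAt).comp_hasDerivAt σ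
    (hd σ).hasDerivAt
  exact h

/-- ‖·‖² and ⟪·,·⟫ of vectors of `ℝ³` in coordinates. [folklore] -/
private theorem norm_sq_fin3 (v : EuclideanSpace ℝ (Fin 3)) : ‖v‖ ^ 2 = v 0 ^ 2 + v 1 ^ 2 + v 2 ^ 2 := by
  rw [EuclideanSpace.norm_sq_eq]
  simp [Fin.sum_univ_three, Real.norm_eq_abs, sq_abs]

/-- `⟪v, w⟫ = Σ vᵢwᵢ` in `ℝ³`. [folklore] -/
private theorem inner_fin3 (v w : EuclideanSpace ℝ (Fin 3)) : ⟪v, w⟫ = v 0 * w 0 + v 1 * w 1 + v 2 * w 2 := by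
  simp only [PiLp.inner_apply, RCLike.inner_apply, conj_trivial, Fin.sum_univ_three]
  ring

section Symm

variable {N : ℕ} {Ξ : Fin N → ℝ → EuclideanSpace ℝ (Fin 3)} {π : Fin N → Fin N} {s c : Fin 3 → ℝ} {ε : ℝ}
  (hd : ∀ k, Differentiable ℝ (Ξ k)) (hs : ∀ i, s i * s i = 1) (hε : ε * ε = 1)
  (hsym : ∀ k σ i, Ξ (π k) (ε * σ) i = s i * Ξ k σ i + c i)
include hd hs hε hsym

omit hs in
/-- Velocity transport: `Ξ_{πk}′(εσ)ᵢ = ε sᵢ Ξ_k′(σ)ᵢ`. [folklore] -/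
theorem deriv_apply_symm (k : Fin N) (σ : ℝ) (i : Fin 3) :
    deriv (Ξ (π k)) (ε * σ) i = ε * s i * deriv (Ξ k) σ i := by
  have h1 : HasDerivAt (fun σ' => Ξ (π k) (ε * σ') i) (deriv (Ξ (π k)) (ε * σ) i * ε) σ := by
    have hl : HasDerivAt (fun σ' : ℝ => ε * σ') (ε * 1) σ := (hasDerivAt_id' σ).const_mul ε
    rw [mul_one] at hl
    have hc := (hasDerivAt_apply (hd (π k)) i (ε * σ)).comp σ hl
    simpa [Function.comp_def] using hc
  have h2 : HasDerivAt (fun σ' => Ξ (π k) (ε * σ') i) (s i * deriv (Ξ k) σ i) σ := by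
    have hb := ((hasDerivAt_apply (hd k) i σ).const_mul (s i)).add_const (c i)
    refine hb.congr_of_eventuallyEq (Eventually.of_forall fun σ' => ?_)
    simp [hsym k σ' i]
  have hu := h1.unique h2
  have hε' := hε
  -- multiply `hu` by ε and use ε² = 1
  have : deriv (Ξ (π k)) (ε * σ) i = deriv (Ξ (π k)) (ε * σ) i * ε * ε := by rw [mul_assoc, hε', mul_one]
  rw [this, hu]
  ring

/-- Integrand transport at an arbitrary field point: for `x′ = Mx + c`, the `i`-th component of the induction
integrand of filament `πk` at parameter `εσ` equals `ε s₀s₁s₂ · sᵢ` times that of filament `k` at `σ`. [folklore] -/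
theorem integrand_apply_symm (k : Fin N) (x x' : EuclideanSpace ℝ (Fin 3)) (hx' : ∀ i, x' i = s i * x i + c i)
    (σ : ℝ) (i : Fin 3) :
    (((‖x' - Ξ (π k) (ε * σ)‖ ^ 2 + 1) ^ (3 / 2 : ℝ))⁻¹ •
        cross (deriv (Ξ (π k)) (ε * σ)) (x' - Ξ (π k) (ε * σ))) i =
      ε * (s 0 * s 1 * s 2) * s i *
        (((‖x - Ξ k σ‖ ^ 2 + 1) ^ (3 / 2 : ℝ))⁻¹ • cross (deriv (Ξ k) σ) (x - Ξ k σ)) i := by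
  have hR : ∀ j, (x' - Ξ (π k) (ε * σ)) j = s j * (x - Ξ k σ) j := by
    intro j; rw [PiLp.sub_apply, PiLp.sub_apply, hx' j, hsym k σ j]; ring
  have hT : ∀ j, deriv (Ξ (π k)) (ε * σ) j = ε * s j * deriv (Ξ k) σ j :=
    fun j => deriv_apply_symm hd hε hsym k σ j
  have hnorm : ‖x' - Ξ (π k) (ε * σ)‖ = ‖x - Ξ k σ‖ := by
    have h2 : ‖x' - Ξ (π k) (ε * σ)‖ ^ 2 = ‖x - Ξ k σ‖ ^ 2 := by
      rw [norm_sq_fin3, norm_sq_fin3, hR 0, hR 1, hR 2]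
      linear_combination ((x - Ξ k σ) 0) ^ 2 * hs 0 + ((x - Ξ k σ) 1) ^ 2 * hs 1 +
        ((x - Ξ k σ) 2) ^ 2 * hs 2
    nlinarith [norm_nonneg (x' - Ξ (π k) (ε * σ)), norm_nonneg (x - Ξ k σ)]
  obtain ⟨c0, c1, c2⟩ := cross_apply_fin3 (deriv (Ξ (π k)) (ε * σ)) (x' - Ξ (π k) (ε * σ))
  obtain ⟨d0, d1, d2⟩ := cross_apply_fin3 (deriv (Ξ k) σ) (x - Ξ k σ)
  fin_cases i
  · simp only [PiLp.smul_apply, smul_eq_mul, hnorm, Fin.zero_eta, c0, d0, hR, hT]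
    linear_combination (ε * s 1 * s 2 * ((‖x - Ξ k σ‖ ^ 2 + 1) ^ (3 / 2 : ℝ))⁻¹ *
      (deriv (Ξ k) σ 1 * (x - Ξ k σ) 2 - deriv (Ξ k) σ 2 * (x - Ξ k σ) 1)) * (-(hs 0))
  · simp only [PiLp.smul_apply, smul_eq_mul, hnorm, Fin.mk_one, c1, d1, hR, hT]
    linear_combination (ε * s 2 * s 0 * ((‖x - Ξ k σ‖ ^ 2 + 1) ^ (3 / 2 : ℝ))⁻¹ *
      (deriv (Ξ k) σ 2 * (x - Ξ k σ) 0 - deriv (Ξ k) σ 0 * (x - Ξ k σ) 2)) * (-(hs 1))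
  · simp only [PiLp.smul_apply, smul_eq_mul, hnorm, Fin.reduceFinMk, c2, d2, hR, hT]
    linear_combination (ε * s 0 * s 1 * ((‖x - Ξ k σ‖ ^ 2 + 1) ^ (3 / 2 : ℝ))⁻¹ *
      (deriv (Ξ k) σ 0 * (x - Ξ k σ) 1 - deriv (Ξ k) σ 1 * (x - Ξ k σ) 0)) * (-(hs 2))

/-- ★ **Transport of one filament's induction**: `u_{πk}(Mx + c)ᵢ = ε s₀s₁s₂ · sᵢ · u_k(x)ᵢ`, given the integrability
clause at `(k, x)` and `(πk, Mx + c)` (substitution `σ ↦ εσ`, `|ε| = 1`). [folklore] -/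
theorem integral_apply_symm (k : Fin N) (x x' : EuclideanSpace ℝ (Fin 3)) (hx' : ∀ i, x' i = s i * x i + c i)
    (hI : Integrable (fun σ : ℝ => ((‖x - Ξ k σ‖ ^ 2 + 1) ^ (3 / 2 : ℝ))⁻¹ •
      cross (deriv (Ξ k) σ) (x - Ξ k σ)))
    (hI' : Integrable (fun σ : ℝ => ((‖x' - Ξ (π k) σ‖ ^ 2 + 1) ^ (3 / 2 : ℝ))⁻¹ •
      cross (deriv (Ξ (π k)) σ) (x' - Ξ (π k) σ))) (i : Fin 3) :
    (∫ σ : ℝ, ((‖x' - Ξ (π k) σ‖ ^ 2 + 1) ^ (3 / 2 : ℝ))⁻¹ •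
        cross (deriv (Ξ (π k)) σ) (x' - Ξ (π k) σ)) i =
      ε * (s 0 * s 1 * s 2) * s i *
        (∫ σ : ℝ, ((‖x - Ξ k σ‖ ^ 2 + 1) ^ (3 / 2 : ℝ))⁻¹ • cross (deriv (Ξ k) σ) (x - Ξ k σ)) i := by
  have habs : |ε⁻¹| = 1 := by
    have h1 : |ε| = 1 := by
      have : |ε| * |ε| = 1 := by rw [← abs_mul, hε, abs_one]
      nlinarith [abs_nonneg ε]
    rw [abs_inv, h1, inv_one]
  have hsub : ∫ σ : ℝ, (((‖x' - Ξ (π k) (ε * σ)‖ ^ 2 + 1) ^ (3 / 2 : ℝ))⁻¹ •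
      cross (deriv (Ξ (π k)) (ε * σ)) (x' - Ξ (π k) (ε * σ))) i =
      ∫ σ : ℝ, (((‖x' - Ξ (π k) σ‖ ^ 2 + 1) ^ (3 / 2 : ℝ))⁻¹ •
        cross (deriv (Ξ (π k)) σ) (x' - Ξ (π k) σ)) i := by
    rw [Measure.integral_comp_mul_left (fun σ => (((‖x' - Ξ (π k) σ‖ ^ 2 + 1) ^ (3 / 2 : ℝ))⁻¹ •
      cross (deriv (Ξ (π k)) σ) (x' - Ξ (π k) σ)) i) ε, habs, one_smul]
  rw [integral_apply_eq hI' i, integral_apply_eq hI i, ← hsub, ← integral_const_mul]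
  exact integral_congr_ae (Eventually.of_forall fun σ => integrand_apply_symm hd hs hε hsym k x x' hx' σ i)

/-- ★ **Transport of the total induction**: with `π` an involution and `γ_{πk} = γ_k`,
`u(Mx + c)ᵢ = κ sᵢ u(x)ᵢ`, `κ = ε s₀s₁s₂`, given the integrability clause of the crux at every `(k, x)`. [folklore] -/
theorem induction_apply_symm (hπ : ∀ k, π (π k) = k) (γ : Fin N → ℝ) (hγ : ∀ k, γ (π k) = γ k) (Γ : ℝ)
    (hint : ∀ k (x : EuclideanSpace ℝ (Fin 3)), Integrable (fun σ : ℝ =>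
      ((‖x - Ξ k σ‖ ^ 2 + 1) ^ (3 / 2 : ℝ))⁻¹ • cross (deriv (Ξ k) σ) (x - Ξ k σ)))
    (x x' : EuclideanSpace ℝ (Fin 3)) (hx' : ∀ i, x' i = s i * x i + c i) (i : Fin 3) :
    (∑ k : Fin N, (Γ * γ k / (4 * Real.pi)) • ∫ σ : ℝ, ((‖x' - Ξ k σ‖ ^ 2 + 1) ^ (3 / 2 : ℝ))⁻¹ •
        cross (deriv (Ξ k) σ) (x' - Ξ k σ)) i =
      ε * (s 0 * s 1 * s 2) * s i *
        (∑ k : Fin N, (Γ * γ k / (4 * Real.pi)) • ∫ σ : ℝ, ((‖x - Ξ k σ‖ ^ 2 + 1) ^ (3 / 2 : ℝ))⁻¹ •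
          cross (deriv (Ξ k) σ) (x - Ξ k σ)) i := by
  set I : Fin N → EuclideanSpace ℝ (Fin 3) := fun k => ∫ σ : ℝ, ((‖x - Ξ k σ‖ ^ 2 + 1) ^ (3 / 2 : ℝ))⁻¹ •
    cross (deriv (Ξ k) σ) (x - Ξ k σ) with hI
  set I' : Fin N → EuclideanSpace ℝ (Fin 3) := fun k => ∫ σ : ℝ, ((‖x' - Ξ k σ‖ ^ 2 + 1) ^ (3 / 2 : ℝ))⁻¹ •
    cross (deriv (Ξ k) σ) (x' - Ξ k σ) with hI'
  have hpart : ∀ k, I' (π k) i = ε * (s 0 * s 1 * s 2) * s i * I k i := fun k =>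
    integral_apply_symm hd hs hε hsym k x x' hx' (hint k x) (hint (π k) x') i
  have hbij : Function.Bijective π := Function.Involutive.bijective hπ
  have hcomp : ∀ (J : Fin N → EuclideanSpace ℝ (Fin 3)),
      (∑ k : Fin N, (Γ * γ k / (4 * Real.pi)) • J k) i = ∑ k : Fin N, Γ * γ k / (4 * Real.pi) * J k i := by
    intro J
    rw [← inner_single_left' i]
    simp_rw [inner_sum, real_inner_smul_right, inner_single_left']
  have hre : ∑ k : Fin N, Γ * γ k / (4 * Real.pi) * I' k i =
      ∑ k : Fin N, Γ * γ (π k) / (4 * Real.pi) * I' (π k) i :=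
    (Fintype.sum_bijective π hbij (fun k => Γ * γ (π k) / (4 * Real.pi) * I' (π k) i)
      (fun k => Γ * γ k / (4 * Real.pi) * I' k i) (fun k => rfl)).symm
  change (∑ k : Fin N, (Γ * γ k / (4 * Real.pi)) • I' k) i =
    ε * (s 0 * s 1 * s 2) * s i * (∑ k : Fin N, (Γ * γ k / (4 * Real.pi)) • I k) i
  rw [hcomp I', hcomp I, hre, Finset.mul_sum]
  refine Finset.sum_congr rfl fun k _ => ?_
  rw [hγ k, hpart k]; ring

/-- ★ **Transport identity.** If the tangency clause of `SkeletonEquilibrium` holds at every `(k, τ)` and the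
translation is vertical (`c₀ = c₁ = 0`), then for all `k, τ` and `κ = ε s₀s₁s₂`, `y = Ξ_k τ`, `t = Ξ_k′ τ`,
`λ = ε w_{πk}(ετ) − κ w_k τ`:
`(1−κ)·½y₀ + α(s₀s₁ − κ)·y₁ = λ t₀`, `(1−κ)·½y₁ − α(s₀s₁ − κ)·y₀ = λ t₁`, `(1−κ)·½y₂ + ½ s₂c₂ = λ t₂`. [folklore] -/
theorem transport_identity (hπ : ∀ k, π (π k) = k) (γ : Fin N → ℝ) (hγ : ∀ k, γ (π k) = γ k)
    (hc : c 0 = 0 ∧ c 1 = 0) (Γ α : ℝ) (w : Fin N → ℝ → ℝ)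
    (hint : ∀ k (x : EuclideanSpace ℝ (Fin 3)), Integrable (fun σ : ℝ =>
      ((‖x - Ξ k σ‖ ^ 2 + 1) ^ (3 / 2 : ℝ))⁻¹ • cross (deriv (Ξ k) σ) (x - Ξ k σ)))
    (heq : ∀ k τ, (∑ m : Fin N, (Γ * γ m / (4 * Real.pi)) • ∫ σ : ℝ,
        ((‖Ξ k τ - Ξ m σ‖ ^ 2 + 1) ^ (3 / 2 : ℝ))⁻¹ • cross (deriv (Ξ m) σ) (Ξ k τ - Ξ m σ)) +
        (1 / 2 : ℝ) • Ξ k τ - α • cross (EuclideanSpace.single (2 : Fin 3) (1 : ℝ)) (Ξ k τ) =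
        w k τ • deriv (Ξ k) τ)
    (k : Fin N) (τ : ℝ) :
    (1 - ε * (s 0 * s 1 * s 2)) * (1 / 2 * Ξ k τ 0) + α * (s 0 * s 1 - ε * (s 0 * s 1 * s 2)) * Ξ k τ 1 =
        (ε * w (π k) (ε * τ) - ε * (s 0 * s 1 * s 2) * w k τ) * deriv (Ξ k) τ 0 ∧
      (1 - ε * (s 0 * s 1 * s 2)) * (1 / 2 * Ξ k τ 1) - α * (s 0 * s 1 - ε * (s 0 * s 1 * s 2)) * Ξ k τ 0 =
        (ε * w (π k) (ε * τ) - ε * (s 0 * s 1 * s 2) * w k τ) * deriv (Ξ k) τ 1 ∧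
      (1 - ε * (s 0 * s 1 * s 2)) * (1 / 2 * Ξ k τ 2) + 1 / 2 * s 2 * c 2 =
        (ε * w (π k) (ε * τ) - ε * (s 0 * s 1 * s 2) * w k τ) * deriv (Ξ k) τ 2 := by
  have hx' : ∀ i, Ξ (π k) (ε * τ) i = s i * Ξ k τ i + c i := fun i => hsym k τ i
  have hu := fun i => induction_apply_symm hd hs hε hsym hπ γ hγ Γ hint (Ξ k τ) (Ξ (π k) (ε * τ)) hx' i
  have hT : ∀ j, deriv (Ξ (π k)) (ε * τ) j = ε * s j * deriv (Ξ k) τ j :=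
    fun j => deriv_apply_symm hd hε hsym k τ j
  obtain ⟨hJ0, hJ1, hJ2⟩ := cross_e3_apply (Ξ k τ)
  obtain ⟨hJ0', hJ1', hJ2'⟩ := cross_e3_apply (Ξ (π k) (ε * τ))
  have h1 := heq k τ
  have h2 := heq (π k) (ε * τ)
  have c1 := fun i => congrArg (fun v => ⟪EuclideanSpace.single i (1 : ℝ), v⟫) h1
  have c2 := fun i => congrArg (fun v => ⟪EuclideanSpace.single i (1 : ℝ), v⟫) h2
  have e10 := c1 0
  have e11 := c1 1
  have e12 := c1 2
  have e20 := c2 0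
  have e21 := c2 1
  have e22 := c2 2
  simp only [inner_add_right, inner_sub_right, real_inner_smul_right, inner_single_left'] at e10 e11 e12
  simp only [inner_add_right, inner_sub_right, real_inner_smul_right, inner_single_left'] at e20 e21 e22
  rw [hu 0, hJ0', hx' 0, hx' 1, hT 0, hc.1, hc.2] at e20
  rw [hu 1, hJ1', hx' 1, hx' 0, hT 1, hc.1, hc.2] at e21
  rw [hu 2, hJ2', hx' 2, hT 2] at e22
  rw [hJ0] at e10
  rw [hJ1] at e11
  rw [hJ2] at e12
  -- abbreviations for readability of the certificates
  set u0 := (∑ m : Fin N, (Γ * γ m / (4 * Real.pi)) • ∫ σ : ℝ, ((‖Ξ k τ - Ξ m σ‖ ^ 2 + 1) ^ (3 / 2 : ℝ))⁻¹ •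
    cross (deriv (Ξ m) σ) (Ξ k τ - Ξ m σ)) 0 with hu0
  set u1 := (∑ m : Fin N, (Γ * γ m / (4 * Real.pi)) • ∫ σ : ℝ, ((‖Ξ k τ - Ξ m σ‖ ^ 2 + 1) ^ (3 / 2 : ℝ))⁻¹ •
    cross (deriv (Ξ m) σ) (Ξ k τ - Ξ m σ)) 1 with hu1
  set u2 := (∑ m : Fin N, (Γ * γ m / (4 * Real.pi)) • ∫ σ : ℝ, ((‖Ξ k τ - Ξ m σ‖ ^ 2 + 1) ^ (3 / 2 : ℝ))⁻¹ •
    cross (deriv (Ξ m) σ) (Ξ k τ - Ξ m σ)) 2 with hu2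
  refine ⟨?_, ?_, ?_⟩
  · linear_combination (s 0) * e20 - (ε * (s 0 * s 1 * s 2)) * e10 +
      (-(1 / 2) * Ξ k τ 0 - ε * (s 0 * s 1 * s 2) * u0 + ε * w (π k) (ε * τ) * deriv (Ξ k) τ 0) * hs 0
  · linear_combination (s 1) * e21 - (ε * (s 0 * s 1 * s 2)) * e11 +
      (-(1 / 2) * Ξ k τ 1 - ε * (s 0 * s 1 * s 2) * u1 + ε * w (π k) (ε * τ) * deriv (Ξ k) τ 1) * hs 1
  · linear_combination (s 2) * e22 - (ε * (s 0 * s 1 * s 2)) * e12 +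
      (-(1 / 2) * Ξ k τ 2 - ε * (s 0 * s 1 * s 2) * u2 + ε * w (π k) (ε * τ) * deriv (Ξ k) τ 2) * hs 2

/-- ★ **Centre law for `κ = −1`.** With `ε s₀s₁s₂ = −1` and vertical translation, for all `k, τ`:
`y₀ + β y₁ = λ t₀`, `y₁ − β y₀ = λ t₁`, `y₂ + ½ s₂c₂ = λ t₂` (`β = α(s₀s₁ + 1)`, `λ = ε w_{πk}(ετ) + w_k τ`),
i.e. `(I − βJ)(Ξ_k τ − p) = λ Ξ_k′ τ` with `p = −½ s₂c₂ e₃` on the axis. [folklore] -/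
theorem centre_law_of_neg (hπ : ∀ k, π (π k) = k) (γ : Fin N → ℝ) (hγ : ∀ k, γ (π k) = γ k)
    (hc : c 0 = 0 ∧ c 1 = 0) (hκ : ε * (s 0 * s 1 * s 2) = -1) (Γ α : ℝ) (w : Fin N → ℝ → ℝ)
    (hint : ∀ k (x : EuclideanSpace ℝ (Fin 3)), Integrable (fun σ : ℝ =>
      ((‖x - Ξ k σ‖ ^ 2 + 1) ^ (3 / 2 : ℝ))⁻¹ • cross (deriv (Ξ k) σ) (x - Ξ k σ)))
    (heq : ∀ k τ, (∑ m : Fin N, (Γ * γ m / (4 * Real.pi)) • ∫ σ : ℝ,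
        ((‖Ξ k τ - Ξ m σ‖ ^ 2 + 1) ^ (3 / 2 : ℝ))⁻¹ • cross (deriv (Ξ m) σ) (Ξ k τ - Ξ m σ)) +
        (1 / 2 : ℝ) • Ξ k τ - α • cross (EuclideanSpace.single (2 : Fin 3) (1 : ℝ)) (Ξ k τ) =
        w k τ • deriv (Ξ k) τ)
    (k : Fin N) (τ : ℝ) :
    Ξ k τ 0 + α * (s 0 * s 1 + 1) * Ξ k τ 1 = (ε * w (π k) (ε * τ) + w k τ) * deriv (Ξ k) τ 0 ∧
      Ξ k τ 1 - α * (s 0 * s 1 + 1) * Ξ k τ 0 = (ε * w (π k) (ε * τ) + w k τ) * deriv (Ξ k) τ 1 ∧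
      Ξ k τ 2 + 1 / 2 * s 2 * c 2 = (ε * w (π k) (ε * τ) + w k τ) * deriv (Ξ k) τ 2 := by
  obtain ⟨h0, h1, h2⟩ := transport_identity hd hs hε hsym hπ γ hγ hc Γ α w hint heq k τ
  rw [hκ] at h0 h1 h2
  refine ⟨?_, ?_, ?_⟩
  · linear_combination h0
  · linear_combination h1
  · linear_combination h2

/-- ★ **Every filament of a `κ = −1`-symmetric relative equilibrium passes through the axis point
`p = −½ s₂c₂ e₃`** (proper + continuous ⇒ `‖Ξ_k − p‖²` has a minimum, where `2⟪Ξ_k − p, Ξ_k′⟫ = 0`; the centre law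
gives `‖Ξ_k − p‖² = λ⟪Ξ_k − p, Ξ_k′⟫`). [folklore] -/
theorem exists_eq_centre_of_neg (hπ : ∀ k, π (π k) = k) (γ : Fin N → ℝ) (hγ : ∀ k, γ (π k) = γ k)
    (hc : c 0 = 0 ∧ c 1 = 0) (hκ : ε * (s 0 * s 1 * s 2) = -1) (Γ α : ℝ) (w : Fin N → ℝ → ℝ)
    (hprop : ∀ k, Tendsto (fun τ => ‖Ξ k τ‖) atTop atTop ∧ Tendsto (fun τ => ‖Ξ k τ‖) atBot atTop)
    (hint : ∀ k (x : EuclideanSpace ℝ (Fin 3)), Integrable (fun σ : ℝ =>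
      ((‖x - Ξ k σ‖ ^ 2 + 1) ^ (3 / 2 : ℝ))⁻¹ • cross (deriv (Ξ k) σ) (x - Ξ k σ)))
    (heq : ∀ k τ, (∑ m : Fin N, (Γ * γ m / (4 * Real.pi)) • ∫ σ : ℝ,
        ((‖Ξ k τ - Ξ m σ‖ ^ 2 + 1) ^ (3 / 2 : ℝ))⁻¹ • cross (deriv (Ξ m) σ) (Ξ k τ - Ξ m σ)) +
        (1 / 2 : ℝ) • Ξ k τ - α • cross (EuclideanSpace.single (2 : Fin 3) (1 : ℝ)) (Ξ k τ) =
        w k τ • deriv (Ξ k) τ)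
    (k : Fin N) : ∃ τ, Ξ k τ = (-(1 / 2) * s 2 * c 2) • EuclideanSpace.single (2 : Fin 3) (1 : ℝ) := by
  set p : EuclideanSpace ℝ (Fin 3) := (-(1 / 2) * s 2 * c 2) • EuclideanSpace.single (2 : Fin 3) (1 : ℝ)
    with hp
  have hp0 : p 0 = 0 := by simp [hp]
  have hp1 : p 1 = 0 := by simp [hp]
  have hp2 : p 2 = -(1 / 2) * s 2 * c 2 := by simp [hp]
  set r : ℝ → EuclideanSpace ℝ (Fin 3) := fun τ => Ξ k τ - p with hr
  set g : ℝ → ℝ := fun τ => ⟪r τ, r τ⟫ with hg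
  have hrc : Continuous r := (hd k).continuous.sub continuous_const
  have hgc : Continuous g := hrc.inner hrc
  have hnorm_tend : ∀ {l : Filter ℝ}, Tendsto (fun τ => ‖Ξ k τ‖) l atTop → Tendsto g l atTop := by
    intro l hl
    have h1 : Tendsto (fun τ => ‖Ξ k τ‖ - ‖p‖) l atTop := tendsto_atTop_add_const_right _ _ hl
    have h2 : Tendsto (fun τ => ‖r τ‖) l atTop :=
      tendsto_atTop_mono (fun τ => by simpa [hr] using norm_sub_norm_le (Ξ k τ) p) h1
    have h3 : Tendsto (fun τ => ‖r τ‖ ^ 2) l atTop := (tendsto_pow_atTop two_ne_zero).comp h2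
    refine h3.congr fun τ => ?_
    simp [hg]
  have hlim : Tendsto g (cocompact ℝ) atTop := by
    rw [cocompact_eq_atBot_atTop]
    exact (hnorm_tend (hprop k).2).sup (hnorm_tend (hprop k).1)
  obtain ⟨τm, hτm⟩ := hgc.exists_forall_le hlim
  have hrd : HasDerivAt r (deriv (Ξ k) τm) τm := by
    simpa [hr] using ((hd k τm).hasDerivAt).sub_const p
  have hgd : HasDerivAt g (⟪r τm, deriv (Ξ k) τm⟫ + ⟪deriv (Ξ k) τm, r τm⟫) τm := hrd.inner ℝ hrd
  have hmin : IsLocalMin g τm := Eventually.of_forall fun y => hτm y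
  have hzero := hmin.hasDerivAt_eq_zero hgd
  have hcomm : ⟪r τm, deriv (Ξ k) τm⟫ = ⟪deriv (Ξ k) τm, r τm⟫ := real_inner_comm _ _
  have hinner0 : ⟪r τm, deriv (Ξ k) τm⟫ = 0 := by linarith
  -- the centre law at τm in terms of r
  obtain ⟨h0, h1, h2⟩ := centre_law_of_neg hd hs hε hsym hπ γ hγ hc hκ Γ α w hint heq k τm
  have hr0 : r τm 0 = Ξ k τm 0 := by simp only [hr, PiLp.sub_apply, hp0, sub_zero]
  have hr1 : r τm 1 = Ξ k τm 1 := by simp only [hr, PiLp.sub_apply, hp1, sub_zero]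
  have hr2 : r τm 2 = Ξ k τm 2 + 1 / 2 * s 2 * c 2 := by simp only [hr, PiLp.sub_apply, hp2]; ring
  have hsq : ‖r τm‖ ^ 2 = (ε * w (π k) (ε * τm) + w k τm) * ⟪r τm, deriv (Ξ k) τm⟫ := by
    rw [norm_sq_fin3, inner_fin3, hr0, hr1, hr2]
    linear_combination (Ξ k τm 0) * h0 + (Ξ k τm 1) * h1 + (Ξ k τm 2 + 1 / 2 * s 2 * c 2) * h2
  rw [hinner0, mul_zero] at hsq
  have : r τm = 0 := by
    have := pow_eq_zero_iff (n := 2) (by norm_num) |>.mp hsq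
    exact norm_eq_zero.mp this
  exact ⟨τm, by simpa [hr, sub_eq_zero] using this⟩

/-- ★ **κ = −1 rigidity.** With, in addition, the separation clause of the crux (`0 < d ≤ ‖Ξ_k τ − Ξ_m σ‖` for
`k ≠ m`), a `κ = −1`-symmetric relative equilibrium has at most one filament. [folklore] -/
theorem subsingleton_of_neg (hπ : ∀ k, π (π k) = k) (γ : Fin N → ℝ) (hγ : ∀ k, γ (π k) = γ k)
    (hc : c 0 = 0 ∧ c 1 = 0) (hκ : ε * (s 0 * s 1 * s 2) = -1) (Γ α d : ℝ) (hdpos : 0 < d)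
    (w : Fin N → ℝ → ℝ)
    (hprop : ∀ k, Tendsto (fun τ => ‖Ξ k τ‖) atTop atTop ∧ Tendsto (fun τ => ‖Ξ k τ‖) atBot atTop)
    (hsep : ∀ k m, k ≠ m → ∀ τ σ, d ≤ ‖Ξ k τ - Ξ m σ‖)
    (hint : ∀ k (x : EuclideanSpace ℝ (Fin 3)), Integrable (fun σ : ℝ =>
      ((‖x - Ξ k σ‖ ^ 2 + 1) ^ (3 / 2 : ℝ))⁻¹ • cross (deriv (Ξ k) σ) (x - Ξ k σ)))
    (heq : ∀ k τ, (∑ m : Fin N, (Γ * γ m / (4 * Real.pi)) • ∫ σ : ℝ,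
        ((‖Ξ k τ - Ξ m σ‖ ^ 2 + 1) ^ (3 / 2 : ℝ))⁻¹ • cross (deriv (Ξ m) σ) (Ξ k τ - Ξ m σ)) +
        (1 / 2 : ℝ) • Ξ k τ - α • cross (EuclideanSpace.single (2 : Fin 3) (1 : ℝ)) (Ξ k τ) =
        w k τ • deriv (Ξ k) τ) :
    ∀ k m : Fin N, k = m := by
  intro k m
  by_contra hkm
  obtain ⟨τ, hτ⟩ := exists_eq_centre_of_neg hd hs hε hsym hπ γ hγ hc hκ Γ α w hprop hint heq k
  obtain ⟨σ, hσ⟩ := exists_eq_centre_of_neg hd hs hε hsym hπ γ hγ hc hκ Γ α w hprop hint heq m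
  have h := hsep k m hkm τ σ
  rw [hτ, hσ, sub_self, norm_zero] at h
  linarith

/-- ★ **Slip law of the compatible symmetries** (`κ = 1`, `s₀s₁ = 1`, `c = 0`: rotations about `e₃` preserving
orientation, `σ_z` or `−I` with reversal): `(ε w_{πk}(ετ) − w_k τ) • Ξ_k′ τ = 0`, i.e. with unit speed
`w_{πk}(ετ) = ε w_k(τ)`. [folklore] -/
theorem slip_law_of_compatible (hπ : ∀ k, π (π k) = k) (γ : Fin N → ℝ) (hγ : ∀ k, γ (π k) = γ k)
    (hc : c 0 = 0 ∧ c 1 = 0 ∧ c 2 = 0) (hκ : ε * (s 0 * s 1 * s 2) = 1) (hs01 : s 0 * s 1 = 1) (Γ α : ℝ)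
    (w : Fin N → ℝ → ℝ) (hunit : ∀ k τ, ‖deriv (Ξ k) τ‖ = 1)
    (hint : ∀ k (x : EuclideanSpace ℝ (Fin 3)), Integrable (fun σ : ℝ =>
      ((‖x - Ξ k σ‖ ^ 2 + 1) ^ (3 / 2 : ℝ))⁻¹ • cross (deriv (Ξ k) σ) (x - Ξ k σ)))
    (heq : ∀ k τ, (∑ m : Fin N, (Γ * γ m / (4 * Real.pi)) • ∫ σ : ℝ,
        ((‖Ξ k τ - Ξ m σ‖ ^ 2 + 1) ^ (3 / 2 : ℝ))⁻¹ • cross (deriv (Ξ m) σ) (Ξ k τ - Ξ m σ)) +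
        (1 / 2 : ℝ) • Ξ k τ - α • cross (EuclideanSpace.single (2 : Fin 3) (1 : ℝ)) (Ξ k τ) =
        w k τ • deriv (Ξ k) τ)
    (k : Fin N) (τ : ℝ) : w (π k) (ε * τ) = ε * w k τ := by
  obtain ⟨h0, h1, h2⟩ := transport_identity hd hs hε hsym hπ γ hγ ⟨hc.1, hc.2.1⟩ Γ α w hint heq k τ
  rw [hκ] at h0 h1 h2
  rw [hs01] at h0 h1
  rw [hc.2.2] at h2
  -- `(ε w̃ − w) tᵢ = 0` for every i, and `Σ tᵢ² = 1`
  have hn := hunit k τ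
  have hn2 : deriv (Ξ k) τ 0 ^ 2 + deriv (Ξ k) τ 1 ^ 2 + deriv (Ξ k) τ 2 ^ 2 = 1 := by
    rw [← norm_sq_fin3, hn, one_pow]
  have key : (ε * w (π k) (ε * τ) - w k τ) *
      (deriv (Ξ k) τ 0 ^ 2 + deriv (Ξ k) τ 1 ^ 2 + deriv (Ξ k) τ 2 ^ 2) = 0 := by
    linear_combination -((deriv (Ξ k) τ 0) * h0 + (deriv (Ξ k) τ 1) * h1 + (deriv (Ξ k) τ 2) * h2)
  rw [hn2, mul_one] at key
  -- multiply `ε w̃ = w` by ε and use ε² = 1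
  linear_combination ε * key - (w (π k) (ε * τ)) * hε

end Symm

end Summit.NavierStokesRegularity.NavierStokesRegularity.Theorems.SkeletonEquilibrium.SymmetryRigidity
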